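import Summits.Ventures.HodgeRepro.Night4ReducedDimQuadTable

/-!
# The choice-function cover of the CM types: every CM type is a choice of one embedding per place

Blind re-derivation cell `pub-hodge-repro`, seat `night-4` (ROUTE HARDENING for the Monday FINAL, gen 6).  Target tree
path `lean/Summits/Ventures/HodgeRepro/Night4ReducedDimTypeCover.lean`.

The kernel tables of gens 1–6 list the CM types of a `(G, c)` explicitly and prove the list complete by `decide +kernel`
over ALL `2^{|G|}` subsets of `G` (`night4Types_*_cover`): 4096 subsets in degree 12, 16384 in degree 14 — and 65536 in
degree 16, beyond one kernel budget (gen 5's ADDENDUM 2, candidate (b)).  This file replaces that check by a THEOREM: a CM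
type contains exactly one embedding of each place `{p, c p}`, so it is the image of a choice function on a list of place
representatives,

* `night4TypeOfChoice c reps bs` — the subset `{if b then r else c r : (r, b) ∈ reps.zip bs}` of a list of representatives
  `reps` and a list of Booleans `bs`;
* `IsCMType.eq_night4TypeOfChoice` — every CM type `Φ` is `night4TypeOfChoice c reps (reps.map fun r => decide (r ∈ Φ))` as soon as
  `reps` meets every place (`∀ p, ∃ r ∈ reps, r = p ∨ c * r = p`, the `night4Reps_*_cover` of gens 1–5);
* `night4BoolLists n` — the `2^n` lists of `n` Booleans, `mem_night4BoolLists` (complete);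
* **`mem_night4AllTypesOfChoice`** — every CM type is in `night4AllTypesOfChoice c reps := (night4BoolLists reps.length).map (night4TypeOfChoice c
  reps)`, and **`mem_night4TypesOneOfChoice`** — every CM type containing `1` is in its `List.filter (1 ∈ ·)`; both THEOREMS, no
  kernel enumeration of subsets.

With it the list of types of a `(G, c)` need not be written out nor covered by `decide`: `night4AllTypesOfChoice` is the `types`
argument of `redDim_faceCorners_of_base_one` (gen 5) and of `night4Quad_of_table` (gen 6), and the Boolean tables run over
it directly (the kernel unfolds `night4BoolLists` and `night4TypeOfChoice` as it goes).  Nothing here says anything about the status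
of the Hodge conjecture for CM abelian varieties, which is NOT proved.
-/

set_option autoImplicit false

open Finset

namespace HodgeRepro

section Choice

variable {G : Type} [Group G] [DecidableEq G]

/-- The subset chosen by `bs` from the places of `reps`: the `r` with `b = true`, the `c r` with `b = false`. -/
def night4TypeOfChoice (c : G) (reps : List G) (bs : List Bool) : Finset G :=
  ((reps.zip bs).map fun rb => if rb.2 then rb.1 else c * rb.1).toFinset

/-- Membership in `night4TypeOfChoice`. -/
theorem mem_night4TypeOfChoice {c : G} {reps : List G} {bs : List Bool} {x : G} :
    x ∈ night4TypeOfChoice c reps bs ↔ ∃ rb ∈ reps.zip bs, x = if rb.2 then rb.1 else c * rb.1 := by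
  unfold night4TypeOfChoice
  rw [List.mem_toFinset, List.mem_map]
  simp only [eq_comm]

/-- `l.zip (l.map f)` pairs every entry with its image. -/
theorem night4_zip_map_self_eq {α β : Type} (l : List α) (f : α → β) : l.zip (l.map f) = l.map fun a => (a, f a) := by
  induction l with
  | nil => rfl
  | cons a l ih => simp [List.zip_cons_cons, ih]

/-- **Every CM type is a choice of one embedding per place**: if `reps` meets every place, then
`Φ = night4TypeOfChoice c reps (reps.map fun r => decide (r ∈ Φ))`. -/
theorem IsCMType.eq_night4TypeOfChoice {c : G} {Φ : Finset G} (hΦ : IsCMType c Φ) (reps : List G)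
    (hcover : ∀ p : G, ∃ r ∈ reps, r = p ∨ c * r = p) :
    Φ = night4TypeOfChoice c reps (reps.map fun r => decide (r ∈ Φ)) := by
  ext x
  rw [mem_night4TypeOfChoice, night4_zip_map_self_eq]
  simp only [List.mem_map, exists_exists_and_eq_and]
  constructor
  · intro hx
    obtain ⟨r, hr, hrx⟩ := hcover x
    refine ⟨r, hr, ?_⟩
    rcases hrx with rfl | rfl
    · simp [hx]
    · have : r ∉ Φ := fun h => hΦ.not_mem_and_conj_mem r ⟨h, hx⟩
      simp [this]
  · rintro ⟨r, -, rfl⟩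
    by_cases h : r ∈ Φ
    · simp [h]
    · simp only [h, decide_false, Bool.false_eq_true, if_false]
      exact (hΦ.mem_or_conj_mem r).resolve_left h

end Choice

/-! ## The lists of Boolean choices -/

/-- The `2^n` lists of `n` Booleans. -/
def night4BoolLists : ℕ → List (List Bool)
  | 0 => [[]]
  | n + 1 => (night4BoolLists n).map (true :: ·) ++ (night4BoolLists n).map (false :: ·)

/-- `night4BoolLists n` contains every list of `n` Booleans. -/
theorem mem_night4BoolLists : ∀ (n : ℕ) (bs : List Bool), bs.length = n → bs ∈ night4BoolLists n
  | 0, bs, h => by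
    rw [List.length_eq_zero_iff] at h
    subst h
    simp [night4BoolLists]
  | n + 1, bs, h => by
    cases bs with
    | nil => simp at h
    | cons b bs' =>
      simp only [List.length_cons, Nat.add_right_cancel_iff] at h
      have ih := mem_night4BoolLists n bs' h
      cases b <;> simp [night4BoolLists, ih]

/-- `night4BoolLists n` has `2^n` entries. -/
theorem length_night4BoolLists (n : ℕ) : (night4BoolLists n).length = 2 ^ n := by
  induction n with
  | zero => rfl
  | succ n ih => simp [night4BoolLists, ih, pow_succ, Nat.mul_two]

section Lists

variable {G : Type} [Group G] [DecidableEq G]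

/-- All CM types of `(G, c)` as choices on `reps` (a list with repetitions allowed; every CM type occurs). -/
def night4AllTypesOfChoice (c : G) (reps : List G) : List (Finset G) :=
  (night4BoolLists reps.length).map (night4TypeOfChoice c reps)

/-- The CM types containing `1`, as choices on `reps`. -/
def night4TypesOneOfChoice (c : G) (reps : List G) : List (Finset G) :=
  (night4AllTypesOfChoice c reps).filter fun Φ => decide ((1 : G) ∈ Φ)

/-- **Every CM type is in `night4AllTypesOfChoice c reps`** once `reps` meets every place — a theorem, not a kernel enumeration
of the `2^{|G|}` subsets. -/
theorem mem_night4AllTypesOfChoice {c : G} (reps : List G)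
    (hcover : ∀ p : G, ∃ r ∈ reps, r = p ∨ c * r = p) (Φ : Finset G) (hΦ : IsCMType c Φ) :
    Φ ∈ night4AllTypesOfChoice c reps := by
  unfold night4AllTypesOfChoice
  rw [List.mem_map]
  exact ⟨reps.map fun r => decide (r ∈ Φ), mem_night4BoolLists _ _ (by simp), (hΦ.eq_night4TypeOfChoice reps hcover).symm⟩

/-- **Every CM type containing `1` is in `night4TypesOneOfChoice c reps`.** -/
theorem mem_night4TypesOneOfChoice {c : G} (reps : List G)
    (hcover : ∀ p : G, ∃ r ∈ reps, r = p ∨ c * r = p) (Φ : Finset G) (hΦ : IsCMType c Φ) (h1 : (1 : G) ∈ Φ) :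
    Φ ∈ night4TypesOneOfChoice c reps := by
  unfold night4TypesOneOfChoice
  rw [List.mem_filter, decide_eq_true_eq]
  exact ⟨mem_night4AllTypesOfChoice reps hcover Φ hΦ, h1⟩

end Lists

end HodgeRepro
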